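import Literature.NumberTheory.LFunctions.ZetaZeroDensityVinogradovKorobovEdge
import HarnessLib

/-!
# RH-FREE — Bellotti 2026: Theorem 1.1 (the `K(T)`-form) implies Theorem 1.2 (`N(σ,T) = O(1)` at the Korobov–Vinogradov edge) («nothing here bears on the truth of RH»)

Topic `Literature/NumberTheory/LFunctions` (RH literature-typing tranche 1, L4 "explicit zero
statistics", gen 10). Label **RH-FREE**. THEOREMS only (no definitions, no named facts). Nothing
here bears on the truth of RH.

In `ZetaZeroDensityVinogradovKorobovEdge.lean` Bellotti's Theorem 1.1 (Bull. Lond. Math. Soc. 58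
(2026), no. 7) is typed with the constants `B, C` allowed to depend on `α` and on the majorant
constant `C_K` of `K(T) ≪ (log log T)^α` (`Bellotti2026_thm11`), and Theorem 1.2 as
`Bellotti2026_thm12`. The source presents Theorem 1.2 as the case of constant `K`: "In particular, we
will show that `N(σ,T)` can be bounded by an absolute constant when `σ` is sufficiently close to the
edge of the Korobov–Vinogradov zero-free region". Here that deduction is carried out in the kernel:
take `α = 0`, `K(T) ≡ A`, `C_K = A` in Theorem 1.1 — then `N(σ,T) ≤ C e^{B} A` for
`σ ≥ 1 − A/((log T)^{2/3}(log log T)^{1/3})`, `T ≥ T₁`: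

* `Bellotti2026_thm11.countRe_le_of_const` — Thm 1.1 at constant `K ≡ A > 0`: `N(σ,T) = O_A(1)` on
  `σ ≥ 1 − kvWidth A T` (no zero-free-region hypothesis needed);
* **`Bellotti2026_thm11.thm12 : Bellotti2026_thm11 → Bellotti2026_thm12`**.

## References

* C. Bellotti, Bull. Lond. Math. Soc. 58 (2026), no. 7 = arXiv:2508.02041v1, Thms 1.1–1.2.
  [Bellotti2026ZeroDensity]
-/

noncomputable section

open Real

namespace Literature.NumberTheory.LFunctions

namespace Bellotti2026_thm11

open Bellotti2026

/-- **Theorem 1.1 at a constant `K ≡ A`** (`α = 0`, `C_K = A`): for every `A > 0` there are `C', T₁`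
with `N(σ,T) ≤ C'` for all `T ≥ T₁` and `σ ≥ 1 − A/((log T)^{2/3}(log log T)^{1/3})`
("`N(σ,T)` can be bounded by an absolute constant … close to the edge of the Korobov–Vinogradov
zero-free region"). [cite: Bellotti2026ZeroDensity, Thm 1.1 and §1 (after Thm 1.1)] -/
theorem countRe_le_of_const (h : Bellotti2026_thm11) {A : ℝ} (hA : 0 < A) :
    ∃ C' T₁ : ℝ, ∀ T : ℝ, T₁ ≤ T → ∀ σ : ℝ, 1 - kvWidth A T ≤ σ → (zetaZeroCountRe σ T : ℝ) ≤ C' := by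
  obtain ⟨B, C, hB, hC, hK⟩ := h 0 zero_lt_one A hA
  -- the constant function `K ≡ A` satisfies `0 < K(T) ≤ A (log log T)^0`
  obtain ⟨T₁, hT₁⟩ := hK (fun _ ↦ A) ⟨0, fun T _ ↦ ⟨hA, by rw [Real.rpow_zero, mul_one]⟩⟩
  refine ⟨C * Real.exp B * A, T₁, fun T hT σ hσ ↦ ?_⟩
  have h1 := hT₁ T hT σ (by simpa [kvWidth] using hσ)
  simpa [Real.rpow_zero] using h1

/-- **Bellotti 2026: Theorem 1.1 implies Theorem 1.2** (PROVED): the `O(1)` bound at the edge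
`σ ≥ 1 − A(log T)^{−2/3}(log log T)^{−1/3}` for every `A > A₀` (indeed for every `A > 0`; the
hypothesis that `A₀` is a zero-free-region constant is not used). [cite: Bellotti2026ZeroDensity, Thms 1.1–1.2] -/
theorem thm12 (h : Bellotti2026_thm11) : Bellotti2026_thm12 := by
  intro A₀ hA₀ _hKV A hA
  exact countRe_le_of_const h (hA₀.trans hA)

end Bellotti2026_thm11

end Literature.NumberTheory.LFunctions

end
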